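import Literature.NumberTheory.Automorphic.AdmissibleTorusOrbit
import Literature.NumberTheory.Automorphic.BorelStabilizerCohomology
import Literature.NumberTheory.Automorphic.TwistedCohomologyFiniteOrbits
import Literature.NumberTheory.Automorphic.TwistedQuotientSubgroupModel
import HarnessLib

/-!
# Orbit representatives and stabilisers in the subgroup models `H ⧸ (U ∩ H)` of the Borel stratum

Topic `NumberTheory/Automorphic`; namespaces `Literature.NumberTheory.Automorphic.TwistedQuotient`
(general subgroup models) and `….ParallelWeight` (the Borel stratum of `GL₂`).  Theorems only.

* `orbitStabilizer_codRestrict_eq` — for `H ≤ 𝒢 ∋ ι(Γ)` the stabiliser of `h (U ∩ H)` in the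
  model `H ⧸ (U ∩ H)` is the stabiliser of `h U` in `𝒢 ⧸ U` (equivariance and injectivity of
  `toQuot`, `TwistedQuotientSubgroupModel`);
* `exists_toOrbitCohomology_ne_zero_subgroupModel` — when `H U = 𝒢` and the `Γ`-orbits on `𝒢 ⧸ U`
  are covered by a finite family of points coming from `H`, a non-zero class of
  `H^q(Γ, Fun(H ⧸ (U ∩ H), V))` has a non-zero restriction `toOrbitCohomology` to the orbit of one of
  them (Shapiro sum decomposition `toOrbitCohomology_pi_bijective`);
* `exists_toOrbitCohomology_ne_zero_borel` — for the Borel stratum of `GL₂` over a number field at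
  principal level `K_f(𝔫)` and `H = H_S`, `S ⊇ {v ∣ 𝔫}`: a non-zero class restricts non-trivially to
  the orbit of a point `diag(t) c (U ∩ H_S)` with `c ∈ GL₂(𝒪̂)` supported at the primes of `𝔫`
  (`BorelOrbitsFinite`, `AdmissibleTorusOrbit.supportedPart`), whose stabiliser is the lattice
  `borelStabilizer 𝔫 t c` of `BorelStabilizerCohomology`. [cite: Harder1987, §2]

## References

* G. Harder, *Eisenstein cohomology of arithmetic groups. The case GL₂*, Invent. Math. 89 (1987), §2.
  [Harder1987]
-/

noncomputable section

open scoped NumberField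
open IsDedekindDomain CategoryTheory

universe u

namespace Literature.NumberTheory.Automorphic

namespace TwistedQuotient

variable {k : Type u} [CommRing k] {Γ 𝒢 : Type u} [Group Γ] [Group 𝒢]
variable (ι : Γ →* 𝒢) (L : Subgroup 𝒢) {V : Type u} [AddCommGroup V] [Module k V]
  (ρ : Representation k Γ V) (H : Subgroup 𝒢) (hι : ∀ γ, ι γ ∈ H)

/-- **Stabilisers in the subgroup model are the stabilisers in `𝒢 ⧸ U`.** [folklore] -/
theorem orbitStabilizer_codRestrict_eq (h : H) :
    orbitStabilizer (ι.codRestrict H hι) (L.subgroupOf H) (h : H ⧸ L.subgroupOf H) =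
      orbitStabilizer ι L ((h : 𝒢) : 𝒢 ⧸ L) := by
  ext γ
  rw [mem_orbitStabilizer_iff, mem_orbitStabilizer_iff, ← (toQuot_injective L H).eq_iff, toQuot_smul,
    toQuot_mk]
  rfl

/-- The points of `H ⧸ (U ∩ H)` over a finite family of points of `𝒢 ⧸ U` in the image of `toQuot`.
[folklore] -/
theorem exists_finset_preimage_toQuot (hHL : ∀ g : 𝒢, ∃ h : H, ∃ l ∈ L, g = h * l)
    (s₀ : Finset (𝒢 ⧸ L)) :
    ∃ s₀' : Finset (H ⧸ L.subgroupOf H), ∀ x, x ∈ s₀' ↔ toQuot L H x ∈ s₀ := by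
  classical
  let e : (H ⧸ L.subgroupOf H) ≃ (𝒢 ⧸ L) := Equiv.ofBijective _ (toQuot_bijective L H hHL)
  refine ⟨s₀.image e.symm, fun x => ?_⟩
  rw [Finset.mem_image]
  constructor
  · rintro ⟨y, hy, rfl⟩
    change e (e.symm y) ∈ s₀
    rwa [Equiv.apply_symm_apply]
  · intro hx
    exact ⟨e x, hx, Equiv.symm_apply_apply e x⟩

/-- **A non-zero class restricts non-trivially to some orbit**, the orbits being represented by a
finite family of points of `H ⧸ (U ∩ H)` lying over a covering family `s₀ ⊆ 𝒢 ⧸ U`. [folklore] -/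
theorem exists_toOrbitCohomology_ne_zero_subgroupModel (hHL : ∀ g : 𝒢, ∃ h : H, ∃ l ∈ L, g = h * l)
    (s₀ : Finset (𝒢 ⧸ L)) (hcov : ∀ c : 𝒢 ⧸ L, ∃ x ∈ s₀, ∃ γ : Γ, ι γ • x = c) (q : ℕ)
    {y : cohomology (ι.codRestrict H hι) (L.subgroupOf H) ρ q} (hy : y ≠ 0) :
    ∃ x : H ⧸ L.subgroupOf H, toQuot L H x ∈ s₀ ∧
      toOrbitCohomology (ι.codRestrict H hι) (L.subgroupOf H) ρ x q y ≠ 0 := by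
  classical
  obtain ⟨s₀', hs₀'⟩ := exists_finset_preimage_toQuot L H hHL s₀
  -- the family `s₀'` covers the orbits of `H ⧸ (U ∩ H)`
  have hcov' : ∀ c : H ⧸ L.subgroupOf H, ∃ x ∈ s₀', ∃ γ : Γ, (ι.codRestrict H hι) γ • x = c := by
    intro c
    obtain ⟨x, hx, γ, hγ⟩ := hcov (toQuot L H c)
    obtain ⟨x', rfl⟩ := (toQuot_bijective L H hHL).2 x
    refine ⟨x', (hs₀' x').2 hx, γ, toQuot_injective L H ?_⟩
    rw [toQuot_smul]
    exact hγ
  obtain ⟨s, hss₀, hdisj, hcov''⟩ := exists_orbit_representatives (ι.codRestrict H hι) (L.subgroupOf H) s₀' hcov'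
  have hinj := (toOrbitCohomology_pi_bijective (ι.codRestrict H hι) (L.subgroupOf H) ρ s hdisj hcov'' q).1
  by_contra hall
  push Not at hall
  refine hy (hinj ?_)
  funext x
  have hx0 : toQuot L H x.1 ∈ s₀ := (hs₀' x.1).1 (hss₀ x.2)
  change toOrbitCohomology (ι.codRestrict H hι) (L.subgroupOf H) ρ x.1 q y =
    toOrbitCohomology (ι.codRestrict H hι) (L.subgroupOf H) ρ x.1 q 0
  rw [hall x.1 hx0, map_zero]

end TwistedQuotient

/-! ### The Borel stratum of `GL₂` -/

namespace ParallelWeight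

open BigHeckeGLn

variable {F : Type} [Field F] [NumberField F]

variable (F) in
/-- **`ι(B(F)) ≤ H_S`.** [cite: Harder1987, §2] -/
theorem borel_globalEmbedding_mem_borelAwayFrom (S : Set (HeightOneSpectrum (𝓞 F))) (γ : borel F) :
    ((globalEmbedding 2 F).comp (borel F).subtype) γ ∈ borelAwayFrom (n := 2) S :=
  globalEmbedding_mem_borelAwayFrom (by rw [← borel_eq_standardParabolicGL]; exact γ.2) S

variable (F) in
/-- The diagonal embedding `ι_S : B(F) →* H_S`. [cite: Harder1987, §2] -/
abbrev borelToAwayFrom (S : Set (HeightOneSpectrum (𝓞 F))) : borel F →* borelAwayFrom (n := 2) S :=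
  ((globalEmbedding 2 F).comp (borel F).subtype).codRestrict (borelAwayFrom (n := 2) S)
    (borel_globalEmbedding_mem_borelAwayFrom F S)

/-- `diag(t) c ∈ H_S` for `c` supported at `S' ⊆ S`. [folklore] -/
theorem glDiagonal_mul_mem_borelAwayFrom {S : Set (HeightOneSpectrum (𝓞 F))} (t : Fin 2 → (FiniteAdeleRing (𝓞 F) F)ˣ)
    {c : FiniteAdelicGL 2 F} (hcS : ∀ v, v ∉ S → localComponent 2 F v c = 1) :
    glDiagonal 2 (FiniteAdeleRing (𝓞 F) F) t * c ∈ borelAwayFrom (n := 2) S := by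
  refine mem_borelAwayFrom_iff.2 fun v hv => ?_
  rw [map_mul, hcS v hv, mul_one]
  refine localComponent_mem_standardParabolicGL_of_blockTriangular ?_ v
  rw [coe_glDiagonal]
  exact Matrix.blockTriangular_diagonal _

/-- **Non-zero classes of the Borel model restrict non-trivially to the orbit of a supported
boundary point.**  For `y ≠ 0` in `H^q(B(F), Fun(H_S ⧸ (K_f(𝔫) ∩ H_S), V))`, `S ⊇ {v ∣ 𝔫}`, there are
`t` and `c ∈ GL₂(𝒪̂)` supported at the primes of `𝔫` with `diag(t) c ∈ H_S` and
`toOrbitCohomology (diag(t) c) y ≠ 0`. [cite: Harder1987, §2] -/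
theorem exists_toOrbitCohomology_ne_zero_borel {𝔫 : Ideal (𝓞 F)} (h𝔫 : 𝔫 ≠ 0)
    {S : Set (HeightOneSpectrum (𝓞 F))} (hS : ∀ v : HeightOneSpectrum (𝓞 F), v.asIdeal ∣ 𝔫 → v ∈ S)
    {k : Type} [CommRing k] {V : Type} [AddCommGroup V] [Module k V] (ρ : Representation k (borel F) V)
    (q : ℕ)
    {y : TwistedQuotient.cohomology (borelToAwayFrom F S)
      (((principalCongruenceLevel 2 F 𝔫).comap (GLn.ofFinite 2 F)).subgroupOf (borelAwayFrom S)) ρ q}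
    (hy : y ≠ 0) :
    ∃ (t : Fin 2 → (FiniteAdeleRing (𝓞 F) F)ˣ) (c : FiniteAdelicGL 2 F), c ∈ glFiniteIntegralLevel 2 F ∧
      (∀ v : HeightOneSpectrum (𝓞 F), ¬ v.asIdeal ∣ 𝔫 → localComponent 2 F v c = 1) ∧
      ∃ (hmem : glDiagonal 2 (FiniteAdeleRing (𝓞 F) F) t * c ∈ borelAwayFrom (n := 2) S),
      TwistedQuotient.toOrbitCohomology (borelToAwayFrom F S)
        (((principalCongruenceLevel 2 F 𝔫).comap (GLn.ofFinite 2 F)).subgroupOf (borelAwayFrom S)) ρ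
        ((⟨_, hmem⟩ : borelAwayFrom (n := 2) S) :
          borelAwayFrom (n := 2) S ⧸ ((principalCongruenceLevel 2 F 𝔫).comap (GLn.ofFinite 2 F)).subgroupOf
            (borelAwayFrom S)) q y ≠ 0 := by
  set L := (principalCongruenceLevel 2 F 𝔫).comap (GLn.ofFinite 2 F) with hL
  have hHL : ∀ g : FiniteAdelicGL 2 F, ∃ h : borelAwayFrom (n := 2) S, ∃ u ∈ L, g = (h : FiniteAdelicGL 2 F) * u :=
    forall_exists_borelAwayFrom_mul S fun k hk hkS =>
      mem_comap_principalCongruenceLevel_of_localComponent h𝔫 hk fun v hv => hkS v (hS v hv)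
  obtain ⟨s₀, hs₀, hcov⟩ := exists_finite_cover_borelOrbits (F := F) h𝔫
  obtain ⟨x, hx, hne⟩ := TwistedQuotient.exists_toOrbitCohomology_ne_zero_subgroupModel
    ((globalEmbedding 2 F).comp (borel F).subtype) L ρ (borelAwayFrom (n := 2) S)
    (borel_globalEmbedding_mem_borelAwayFrom F S) hHL s₀ hcov q hy
  obtain ⟨t, c, hc, hxe⟩ := hs₀ _ hx
  -- replace `c` by its part supported at the primes of `𝔫`
  set c' := supportedPart {v : HeightOneSpectrum (𝓞 F) | v.asIdeal ∣ 𝔫} c hc with hc'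
  have hc'S : ∀ v : HeightOneSpectrum (𝓞 F), ¬ v.asIdeal ∣ 𝔫 → localComponent 2 F v c' = 1 :=
    fun v hv => localComponent_supportedPart_of_not_mem hc hv
  have hmem : glDiagonal 2 (FiniteAdeleRing (𝓞 F) F) t * c' ∈ borelAwayFrom (n := 2) S :=
    glDiagonal_mul_mem_borelAwayFrom t fun v hv => hc'S v fun h => hv (hS v h)
  refine ⟨t, c', supportedPart_mem_glFiniteIntegralLevel _ hc, hc'S, hmem, ?_⟩
  -- the point `x` IS `diag(t) c' (L ∩ H_S)`
  have hx' : x = ((⟨_, hmem⟩ : borelAwayFrom (n := 2) S) : borelAwayFrom (n := 2) S ⧸ L.subgroupOf (borelAwayFrom S)) := by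
    refine TwistedQuotient.toQuot_injective L (borelAwayFrom (n := 2) S) ?_
    rw [hxe, TwistedQuotient.toQuot_mk]
    exact coe_glDiagonal_mul_eq_coe_glDiagonal_mul_supportedPart h𝔫 (fun v hv => hv) t hc
  rw [← hx']
  exact hne

end ParallelWeight

end Literature.NumberTheory.Automorphic
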